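import Summits.AtomisticToContinuum.HydrodynamicLimit.Theses.OneFlightGossipEngine
import Literature.Analysis.FluidPDE.HardSphereCollisionRecord
import HarnessLib

/-!
# Definitions of line `Sketch` of crux `SuperExponentialEnergyTails` (stmt-AtomisticToContinuum-17701), part B:
# the UNGAUGED Gevrey moment scheme

Support file (`--supports stmt-AtomisticToContinuum-17701`) of the registered skeleton
`Cruxes/SuperExponentialEnergyTails/Lines/Sketch.lean` (lead prover-line-stmt-AtomisticToContinuum-17701-0),
skeleton v2.  Part A (`…SuperExponentialEnergyTailsDefs`) typed the Gaussian-class hierarchies; this part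
types the objects and propositions of the reshaped line:

* Objects (abbreviations over the prelude only): the normalised absolute velocity moment
  `velMoment Φ P p s = ∫ (N+1)⁻¹ ∑ᵢ ‖vᵢ(Φ_s z)‖ᵖ dP`, the three normalised expected collision sums of a
  window `(s, s']` — `preMomentSum` (`∑_records ‖v_fst⁻‖ᵖ`), `postMomentSum` (`∑_records ‖v_fst⁺‖ᵖ`),
  `pairMomentSum` (`∑_records ‖v_fst⁻‖ᵖ ‖v_snd⁻‖^{p'}`) — and the collision-frequency scale
  `collisionScale σ N = σ² (N+1)^{1/3}` (= `(N+1) ε_N²`, fixed reduced density).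
* `VelocityMomentGevreyHierarchy β` — the C⁺ of the line: `E[(N+1)⁻¹∑ᵢ‖vᵢ(s)‖^{2k}] ≤ C Aᵏ k^{βk}` for every
  order `k`, for `N ≥ N₀(k)`, in the frame of the crux.  For `β < 2` it implies SEET (choose the order after the
  level); the line produces it at `β = 3/2`.
* The three TRUE-LAW contact inputs (conjecture-grade, `k`-wise in `N`, constants chosen after `t < T`):
  `PovznerCeiling` (the empirical impact law of energetic collisions is diffuse: Povzner's angular constant
  `C_SD/(k+1)`, symmetrised form), `ChaosCeiling` (one-sided molecular chaos at contact for the pair marks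
  `‖v⁻‖^{2j}‖v_*⁻‖^{2l}`, constant polynomial in `min j l` — hot spots of the profile are allowed to cost a
  power of the order, which the Gevrey weight absorbs), `RateFloor` (energetic spheres collide at rate
  `≳ ν_N ‖v‖`).
* The two UNCONDITIONAL `N`-side inputs: `MomentRegularity` (finiteness, continuity in time, mass, energy
  conservation, Lyapunov interpolation, Gaussian initial class of the moments, and the exact power ledger
  `velMoment (s') + preMomentSum = velMoment (s) + postMomentSum`).
* The ABSTRACT induction `GevreyInduction` (pure real analysis: a family of continuous functions with the
  Povzner balance inequalities, Lyapunov log-convexity, bounded energy and Gaussian initial data is of Gevrey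
  class `k^{3k/2}`, constants uniform in the truncation order, the horizon and the frequency scale `ν`), over
  the hypothesis structure `MomentSystem`.

Route-internal propositions in the vocabulary of the crux, not cited facts; the three contact inputs are the
order-uniform twins of the filed primitives RF₂ / SD / S2a″ of crux `EnergyCurrentTails` (stmt-9235).
-/

noncomputable section

namespace Summit.AtomisticToContinuum.HydrodynamicLimit.Theorems.SuperExponentialEnergyTailsLine

open scoped BigOperators ENNReal
open MeasureTheory Set
open Literature.MathematicalPhysics.KineticTheory Literature.Analysis.FluidPDE

/-! ## §1 Objects -/

variable {N : ℕ} {ε : ℝ}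

/-- The **normalised absolute velocity moment of order `p`** at time `s` of the law `P` transported by the
flow `Φ`: `∫ (N+1)⁻¹ ∑ᵢ ‖vᵢ(Φ_s z)‖ᵖ dP(z)` (extended non-negative real). [folklore] -/
def velMoment (Φ : HardSphereFlow (Torus.geometry (Fin 3)) ε (N + 1))
    (P : Measure (Config (N + 1) (Fin 3) T3)) (p : ℕ) (s : ℝ) : ℝ≥0∞ :=
  ∫⁻ z, ENNReal.ofReal (((N : ℝ) + 1)⁻¹ * ∑ i : Fin (N + 1), ‖(Φ.flow s z i).2‖ ^ p) ∂P

/-- The **normalised expected pre-collisional power sum** of the window `(s, s']`: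
`∫ (N+1)⁻¹ ∑_{records c, c.time ∈ (s,s']} (‖c.preVel.1‖ᵖ + ‖c.preVel.2‖ᵖ)/2 dP` — ordered records count each
binary collision twice, so a collision of `{i, j}` contributes exactly `‖vᵢ⁻‖ᵖ + ‖vⱼ⁻‖ᵖ` (the symmetric
half-kernel form of the landed quartic ledger `QuarticSchurLedger.stub_quarticLedger`). The LOSS side of the
power ledger. [folklore] -/
def preMomentSum (Φ : HardSphereFlow (Torus.geometry (Fin 3)) ε (N + 1))
    (P : Measure (Config (N + 1) (Fin 3) T3)) (p : ℕ) (s s' : ℝ) : ℝ≥0∞ :=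
  ∫⁻ z, ENNReal.ofReal (((N : ℝ) + 1)⁻¹ *
    Φ.collisionSum (Set.Ioc s s') (fun c => (‖c.preVel.1‖ ^ p + ‖c.preVel.2‖ ^ p) / 2) z) ∂P

/-- The **normalised expected post-collisional power sum** of the window `(s, s']`:
`∫ (N+1)⁻¹ ∑_{records c, c.time ∈ (s,s']} (‖c.postVel.1‖ᵖ + ‖c.postVel.2‖ᵖ)/2 dP` (a collision of `{i, j}`
contributes `‖vᵢ⁺‖ᵖ + ‖vⱼ⁺‖ᵖ`). The GAIN side of the power ledger. [folklore] -/
def postMomentSum (Φ : HardSphereFlow (Torus.geometry (Fin 3)) ε (N + 1))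
    (P : Measure (Config (N + 1) (Fin 3) T3)) (p : ℕ) (s s' : ℝ) : ℝ≥0∞ :=
  ∫⁻ z, ENNReal.ofReal (((N : ℝ) + 1)⁻¹ *
    Φ.collisionSum (Set.Ioc s s') (fun c => (‖c.postVel.1‖ ^ p + ‖c.postVel.2‖ ^ p) / 2) z) ∂P

/-- The **normalised expected pre-collisional pair mark** of orders `(p, p')` of the window `(s, s']`:
`∫ (N+1)⁻¹ ∑_{records c, c.time ∈ (s,s']} ‖c.preVel.1‖ᵖ ‖c.preVel.2‖^{p'} dP` — the bilinear contact
functional a Povzner gain estimate produces (a collision of `{i, j}` contributes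
`‖vᵢ⁻‖ᵖ‖vⱼ⁻‖^{p'} + ‖vⱼ⁻‖ᵖ‖vᵢ⁻‖^{p'}`; in particular `preMomentSum p = (pairMomentSum p 0 + pairMomentSum 0 p)/2`
on the good set). [folklore] -/
def pairMomentSum (Φ : HardSphereFlow (Torus.geometry (Fin 3)) ε (N + 1))
    (P : Measure (Config (N + 1) (Fin 3) T3)) (p p' : ℕ) (s s' : ℝ) : ℝ≥0∞ :=
  ∫⁻ z, ENNReal.ofReal (((N : ℝ) + 1)⁻¹ *
    Φ.collisionSum (Set.Ioc s s') (fun c => ‖c.preVel.1‖ ^ p * ‖c.preVel.2‖ ^ p') z) ∂P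

/-- The **collision-frequency scale** at fixed reduced density: `ν_N = σ² (N+1)^{1/3} = (N+1) ε_N²` — a sphere of
unit speed sweeps `≍ ν_N` partners per unit macroscopic time. [folklore] -/
def collisionScale (σ : ℝ) (N : ℕ) : ℝ :=
  σ ^ 2 * ((N : ℝ) + 1) ^ ((1 : ℝ) / 3)

/-- The collision-frequency scale is positive for `σ > 0` (registered stub `stub_collisionScale_pos` of line Sketch:
the hypothesis `0 < ν` of `GevreyInduction` in `stub_gevreyHierarchyOfInputs`). [folklore] -/
theorem stub_collisionScale_pos : ∀ (σ : ℝ) (N : ℕ), 0 < σ → 0 < Summit.AtomisticToContinuum.HydrodynamicLimit.Theorems.SuperExponentialEnergyTailsLine.collisionScale σ N := by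
  intro σ N hσ
  unfold collisionScale
  positivity

/-! ## §2 The transfer target: Gevrey moment hierarchy under the true law -/

/-- **`VelocityMomentGevreyHierarchy β` (C⁺ of line Sketch; true law, fixed-time marginals, `k`-wise in `N`).**
In the frame of the crux: for every `t < T` there are `A, C > 0` such that for every order `k` there is `N₀`
with `E_{λ₀}[(N+1)⁻¹∑ᵢ ‖vᵢ(Φ_N(s) z)‖^{2k}] ≤ C · Aᵏ · k^{βk}` for all `N ≥ N₀`, `s ∈ [0, t]`.  For `β = 1` this is
the Gaussian class, for `β < 2` it still implies SEET (registered stub `stub_seetOfGevreyHierarchy`); the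
line produces `β = 3/2` (registered stub `stub_gevreyHierarchyOfInputs`).  Route-internal proposition of line
Sketch, crux SuperExponentialEnergyTails, not a cited fact. -/
def VelocityMomentGevreyHierarchy (β : ℝ) : Prop :=
  ∀ (a₀ θ₀ : T3 → ℝ) (u₀ : T3 → V3), Continuous a₀ → Continuous θ₀ → Continuous u₀ →
    (∀ x, 0 < a₀ x) → (∀ x, 0 < θ₀ x) →
    ∃ σ₀ : ℝ, 0 < σ₀ ∧ ∀ σ : ℝ, 0 < σ → σ < σ₀ →
      ∀ (T : ℝ) (ρ θ : ℝ → T3 → ℝ) (u : ℝ → T3 → V3), IsHardSphereEulerSolution σ T ρ u θ →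
        ∀ Φ : (N : ℕ) → HardSphereFlow (Torus.geometry (Fin 3)) (hsDiameter σ N) (N + 1),
          TendstoHydroFieldsAt (fun N => localGibbsLaw σ a₀ u₀ θ₀ N (Φ N)) Φ ρ u θ 0 →
            ∀ t ∈ Set.Ico 0 T, ∃ A : ℝ, 0 < A ∧ ∃ C : ℝ, 0 < C ∧ ∀ k : ℕ, ∃ N₀ : ℕ, ∀ N : ℕ, N₀ ≤ N →
              ∀ s ∈ Set.Icc 0 t,
                velMoment (Φ N) (localGibbsLaw σ a₀ u₀ θ₀ N (Φ N)) (2 * k) s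
                  ≤ ENNReal.ofReal (C * A ^ k * (k : ℝ) ^ (β * k))

/-! ## §3 The three true-law contact inputs -/

/-- **`PovznerCeiling` (conjecture-grade; true pre-shock law; SPLIT input, order-uniform).**  In the frame of the
crux, for every `t < T` there is `C_SD > 0` such that for every order `k ≥ 1` there is `N₀` with, for all
`N ≥ N₀` and windows `0 ≤ s ≤ s' ≤ t`:
`postMomentSum (2k) ≤ γ_k · preMomentSum (2k) + (γ_k/2) · ∑_{0<j<k} C(k,j) · pairMomentSum (2j) (2(k−j))`,
`γ_k = C_SD/(k+1)` — Povzner's inequality `E_ω[‖v′‖^{2k} + ‖v_*′‖^{2k}] ≤ γ_k (‖v‖² + ‖v_*‖²)ᵏ` summed over the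
collisions of the window, i.e. the EMPIRICAL impact law of the collisions under the true law is dominated by a
constant times the flux-uniform one, UNIFORMLY in the order (flux-uniform value `γ_k ≤ 2/(k+1)`,
`IdeatorTwoR1.angular_constant_uniform`).  The `k = 2` deficit form is the filed `QuarticSplitDeficit` of crux
9235.  Why it might fail: grazing- or swap-dominated impact statistics of energetic collisions (a fast sphere
skimming a wake, collinear platoons) under the evolved law, `N`-uniformly.  Route-internal proposition of line
Sketch, crux SuperExponentialEnergyTails (registered stub `stub_povznerCeiling`), not a cited fact. -/
def PovznerCeiling : Prop :=
  ∀ (a₀ θ₀ : T3 → ℝ) (u₀ : T3 → V3), Continuous a₀ → Continuous θ₀ → Continuous u₀ →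
    (∀ x, 0 < a₀ x) → (∀ x, 0 < θ₀ x) →
    ∃ σ₀ : ℝ, 0 < σ₀ ∧ ∀ σ : ℝ, 0 < σ → σ < σ₀ →
      ∀ (T : ℝ) (ρ θ : ℝ → T3 → ℝ) (u : ℝ → T3 → V3), IsHardSphereEulerSolution σ T ρ u θ →
        ∀ Φ : (N : ℕ) → HardSphereFlow (Torus.geometry (Fin 3)) (hsDiameter σ N) (N + 1),
          TendstoHydroFieldsAt (fun N => localGibbsLaw σ a₀ u₀ θ₀ N (Φ N)) Φ ρ u θ 0 →
            ∀ t ∈ Set.Ico 0 T, ∃ CSD : ℝ, 0 < CSD ∧ ∀ k : ℕ, 1 ≤ k → ∃ N₀ : ℕ, ∀ N : ℕ, N₀ ≤ N →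
              ∀ s s' : ℝ, 0 ≤ s → s ≤ s' → s' ≤ t →
                (let P := localGibbsLaw σ a₀ u₀ θ₀ N (Φ N)
                 postMomentSum (Φ N) P (2 * k) s s'
                   ≤ ENNReal.ofReal (CSD / ((k : ℝ) + 1)) * preMomentSum (Φ N) P (2 * k) s s'
                     + ENNReal.ofReal (CSD / ((k : ℝ) + 1) / 2) *
                       ∑ j ∈ Finset.Ioo 0 k, (k.choose j : ℝ≥0∞) * pairMomentSum (Φ N) P (2 * j) (2 * (k - j)) s s')

/-- **`ChaosCeiling` (conjecture-grade; true pre-shock law; one-sided molecular chaos at contact for pair marks,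
order-polynomial constant).**  In the frame of the crux, for every `t < T` there are `C_G > 0` and an exponent
`q : ℕ` such that for all orders `j, l : ℕ` (order `0` included: `l = 0` is the one-particle collision-RATE CEILING
`preMomentSum (2j) ≤ ν_N C_G ∫ (M_{2j+1} + M_{2j} M_1)`, the companion of `RateFloor`, which also makes every collision
power sum finite) there is `N₀` with, for all `N ≥ N₀` and windows `0 ≤ s ≤ s' ≤ t`:
`pairMomentSum (2j) (2l) (s,s'] ≤ ν_N · C_G (1 + min j l)^q · ∫_{(s,s']} (M_{2j+1} M_{2l} + M_{2j} M_{2l+1})(r) dr`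
(`M_p(r) = velMoment p r`, `ν_N = collisionScale σ N`; the half powers are the flux weight `‖v − v_*‖ ≤ ‖v‖ + ‖v_*‖`).
The annealed contact intensity of pairs with marks `(‖v⁻‖^{2j}, ‖v_*⁻‖^{2l})` is at most a constant times its
molecular-chaos (product) value; the constant may grow POLYNOMIALLY in the lower order — this is what spatial
hot spots of the temperature / velocity profile cost against products of space-AVERAGED moments (the obstruction
that refuted the order-uniform ungauged `ContactIntensityDomination`, stmt-9218), and what the Gevrey weight of
the induction absorbs.  `(j, l) = (1, 1)` is the filed `EnergyFluxCeilingWindows` of crux 9235.  Why it might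
fail: dynamical over-production of fast–fast / fast–dense encounters (transient hot micro-clusters, focusing trees
of non-vanishing weight) under the evolved law.  Route-internal proposition of line Sketch, crux
SuperExponentialEnergyTails (registered stub `stub_chaosCeiling`), not a cited fact. -/
def ChaosCeiling : Prop :=
  ∀ (a₀ θ₀ : T3 → ℝ) (u₀ : T3 → V3), Continuous a₀ → Continuous θ₀ → Continuous u₀ →
    (∀ x, 0 < a₀ x) → (∀ x, 0 < θ₀ x) →
    ∃ σ₀ : ℝ, 0 < σ₀ ∧ ∀ σ : ℝ, 0 < σ → σ < σ₀ →
      ∀ (T : ℝ) (ρ θ : ℝ → T3 → ℝ) (u : ℝ → T3 → V3), IsHardSphereEulerSolution σ T ρ u θ →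
        ∀ Φ : (N : ℕ) → HardSphereFlow (Torus.geometry (Fin 3)) (hsDiameter σ N) (N + 1),
          TendstoHydroFieldsAt (fun N => localGibbsLaw σ a₀ u₀ θ₀ N (Φ N)) Φ ρ u θ 0 →
            ∀ t ∈ Set.Ico 0 T, ∃ CG : ℝ, 0 < CG ∧ ∃ q : ℕ, ∀ j l : ℕ, ∃ N₀ : ℕ, ∀ N : ℕ, N₀ ≤ N →
              ∀ s s' : ℝ, 0 ≤ s → s ≤ s' → s' ≤ t →
                (let P := localGibbsLaw σ a₀ u₀ θ₀ N (Φ N)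
                 pairMomentSum (Φ N) P (2 * j) (2 * l) s s'
                   ≤ ENNReal.ofReal (collisionScale σ N * CG * (1 + (min j l : ℝ)) ^ q) *
                     ∫⁻ r in Set.Ioc s s', (velMoment (Φ N) P (2 * j + 1) r * velMoment (Φ N) P (2 * l) r
                       + velMoment (Φ N) P (2 * j) r * velMoment (Φ N) P (2 * l + 1) r))

/-- **`RateFloor` (conjecture-grade; true pre-shock law; destruction FLOOR, weight-uniform in the order).**  In the
frame of the crux, for every `t < T` there are `K₁ > 0`, `K₂ ≥ 0` such that for every order `k ≥ 1` there is `N₀`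
with, for all `N ≥ N₀` and windows `0 ≤ s ≤ s' ≤ t`:
`ν_N K₁ ∫_{(s,s']} M_{2k+1}(r) dr ≤ preMomentSum (2k) (s,s'] + ν_N K₂ ∫_{(s,s']} M_{2k}(r) dr`
— spheres carrying the weight `‖v‖^{2k}` are hit at rate at least `ν_N (K₁‖v‖ − K₂)` (Boltzmann–Enskog's
hard-sphere collision frequency, up to the pre-shock bounds on density and temperature absorbed in `K₁, K₂`),
with constants that do NOT depend on the order.  The structural necessity of a floor at fixed density is the
9235 strategist's D0; its `k = 2` instance is the filed `FastCollisionRateQuartic` (RF₂).  Why it might fail: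
dynamically created fast spheres in co-moving / depleted corridors (wakes, jets) with mean rate `≪ ν_N ‖v‖`;
entropy cannot exclude it.  Route-internal proposition of line Sketch, crux SuperExponentialEnergyTails
(registered stub `stub_rateFloor`), not a cited fact. -/
def RateFloor : Prop :=
  ∀ (a₀ θ₀ : T3 → ℝ) (u₀ : T3 → V3), Continuous a₀ → Continuous θ₀ → Continuous u₀ →
    (∀ x, 0 < a₀ x) → (∀ x, 0 < θ₀ x) →
    ∃ σ₀ : ℝ, 0 < σ₀ ∧ ∀ σ : ℝ, 0 < σ → σ < σ₀ →
      ∀ (T : ℝ) (ρ θ : ℝ → T3 → ℝ) (u : ℝ → T3 → V3), IsHardSphereEulerSolution σ T ρ u θ →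
        ∀ Φ : (N : ℕ) → HardSphereFlow (Torus.geometry (Fin 3)) (hsDiameter σ N) (N + 1),
          TendstoHydroFieldsAt (fun N => localGibbsLaw σ a₀ u₀ θ₀ N (Φ N)) Φ ρ u θ 0 →
            ∀ t ∈ Set.Ico 0 T, ∃ K₁ : ℝ, 0 < K₁ ∧ ∃ K₂ : ℝ, 0 ≤ K₂ ∧ ∀ k : ℕ, 1 ≤ k → ∃ N₀ : ℕ, ∀ N : ℕ, N₀ ≤ N →
              ∀ s s' : ℝ, 0 ≤ s → s ≤ s' → s' ≤ t →
                (let P := localGibbsLaw σ a₀ u₀ θ₀ N (Φ N)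
                 ENNReal.ofReal (collisionScale σ N * K₁) * ∫⁻ r in Set.Ioc s s', velMoment (Φ N) P (2 * k + 1) r
                   ≤ preMomentSum (Φ N) P (2 * k) s s'
                     + ENNReal.ofReal (collisionScale σ N * K₂) * ∫⁻ r in Set.Ioc s s', velMoment (Φ N) P (2 * k) r)

/-! ## §4 The unconditional `N`-side input: regularity and the exact power ledger of the moments -/

/-- **`MomentRegularityFor σ a₀ u₀ θ₀` (provable; `N`-side infrastructure).**  For the local Gibbs law with the
given data transported by ANY hard-sphere flow of `N + 1` spheres of diameter `hsDiameter σ N`: the normalised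
moments `M_p(s) = velMoment Φ λ p s` are finite; `s ↦ M_p(s)` is continuous on `[0, ∞)` (velocities are
right-constant between the locally finitely many collisions, collisions at a fixed time are null, energy
dominates); `M_0 ≡ 1` (probability); `M_2(s) = M_2(0)` (energy conservation); Lyapunov's interpolation
`M_p ≤ M_{p₀}^{(p₁−p)/(p₁−p₀)} M_{p₁}^{(p−p₀)/(p₁−p₀)}` (Hölder); the Gaussian initial class `M_{2k}(0) ≤ C₀ A₀ᵏ k!`
with `C₀, A₀` depending on the data only; and the EXACT POWER LEDGER
`M_p(s') + preMomentSum p (s,s'] = M_p(s) + postMomentSum p (s,s']` for `0 ≤ s ≤ s'` (free flight keeps speeds;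
at a collision only the pair jumps; template: the landed quartic ledger `QuarticSchurLedger.stub_quarticLedger`).
Route-internal proposition of line Sketch, crux SuperExponentialEnergyTails (registered stub
`stub_momentRegularity`), not a cited fact. -/
structure MomentRegularityFor (σ : ℝ) (a₀ : T3 → ℝ) (u₀ : T3 → V3) (θ₀ : T3 → ℝ) : Prop where
  finite : ∀ (N : ℕ) (Φ : HardSphereFlow (Torus.geometry (Fin 3)) (hsDiameter σ N) (N + 1)) (p : ℕ) (s : ℝ),
    velMoment Φ (localGibbsLaw σ a₀ u₀ θ₀ N Φ) p s < ∞
  continuousOn : ∀ (N : ℕ) (Φ : HardSphereFlow (Torus.geometry (Fin 3)) (hsDiameter σ N) (N + 1)) (p : ℕ),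
    ContinuousOn (fun s => (velMoment Φ (localGibbsLaw σ a₀ u₀ θ₀ N Φ) p s).toReal) (Set.Ici 0)
  mass : ∀ (N : ℕ) (Φ : HardSphereFlow (Torus.geometry (Fin 3)) (hsDiameter σ N) (N + 1)) (s : ℝ),
    velMoment Φ (localGibbsLaw σ a₀ u₀ θ₀ N Φ) 0 s = 1
  energy : ∀ (N : ℕ) (Φ : HardSphereFlow (Torus.geometry (Fin 3)) (hsDiameter σ N) (N + 1)) (s : ℝ),
    velMoment Φ (localGibbsLaw σ a₀ u₀ θ₀ N Φ) 2 s = velMoment Φ (localGibbsLaw σ a₀ u₀ θ₀ N Φ) 2 0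
  lyapunov : ∀ (N : ℕ) (Φ : HardSphereFlow (Torus.geometry (Fin 3)) (hsDiameter σ N) (N + 1)) (p₀ p p₁ : ℕ),
    p₀ < p → p < p₁ → ∀ s : ℝ,
      velMoment Φ (localGibbsLaw σ a₀ u₀ θ₀ N Φ) p s
        ≤ velMoment Φ (localGibbsLaw σ a₀ u₀ θ₀ N Φ) p₀ s ^ (((p₁ : ℝ) - p) / ((p₁ : ℝ) - p₀))
          * velMoment Φ (localGibbsLaw σ a₀ u₀ θ₀ N Φ) p₁ s ^ (((p : ℝ) - p₀) / ((p₁ : ℝ) - p₀))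
  initial : ∃ C₀ : ℝ, 0 < C₀ ∧ ∃ A₀ : ℝ, 0 < A₀ ∧
    ∀ (N : ℕ) (Φ : HardSphereFlow (Torus.geometry (Fin 3)) (hsDiameter σ N) (N + 1)) (k : ℕ),
      velMoment Φ (localGibbsLaw σ a₀ u₀ θ₀ N Φ) (2 * k) 0 ≤ ENNReal.ofReal (C₀ * A₀ ^ k * (k.factorial : ℝ))
  ledger : ∀ (N : ℕ) (Φ : HardSphereFlow (Torus.geometry (Fin 3)) (hsDiameter σ N) (N + 1)) (p : ℕ) (s s' : ℝ),
    0 ≤ s → s ≤ s' →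
      velMoment Φ (localGibbsLaw σ a₀ u₀ θ₀ N Φ) p s' + preMomentSum Φ (localGibbsLaw σ a₀ u₀ θ₀ N Φ) p s s'
        = velMoment Φ (localGibbsLaw σ a₀ u₀ θ₀ N Φ) p s + postMomentSum Φ (localGibbsLaw σ a₀ u₀ θ₀ N Φ) p s s'

/-- **`MomentRegularity`**: `MomentRegularityFor σ a₀ u₀ θ₀` for all continuous data `a₀, θ₀ > 0`, `u₀` and every
reduced density `0 < σ < 1/2` (the range of Alexander's theorem on the torus, where the local Gibbs laws are
probability measures and the torus geometry is hard-sphere regular). Route-internal proposition of line Sketch,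
crux SuperExponentialEnergyTails (registered stub `stub_momentRegularity`), not a cited fact. -/
def MomentRegularity : Prop :=
  ∀ (a₀ θ₀ : T3 → ℝ) (u₀ : T3 → V3), Continuous a₀ → Continuous θ₀ → Continuous u₀ →
    (∀ x, 0 < a₀ x) → (∀ x, 0 < θ₀ x) → ∀ σ : ℝ, 0 < σ → σ < 1 / 2 → MomentRegularityFor σ a₀ u₀ θ₀

/-! ## §5 The abstract Gevrey induction (pure real analysis) -/

/-- **`MomentSystem` — the abstract hypotheses of the Bobylev/Desvillettes induction on `[0, t]`.**
`m p s` plays the `p`-th absolute velocity moment at time `s` (all orders `p : ℕ`, integer and "half" = odd);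
`ν > 0` the collision-frequency scale; `n` the truncation order; `k₁` the first order at which the Povzner
constant `C_SD/(k+1)` is at most `1/2`.  Fields: non-negativity, mass `m 0 ≤ 1`, energy `m 2 ≤ E₁`, continuity on
`[0,t]`, Lyapunov log-convexity in the order, Gaussian initial class `m (2k) 0 ≤ C₀ A₀ᵏ k!`, and for
`k₁ ≤ k ≤ n` the POVZNER BALANCE in integral form on every window `0 ≤ s ≤ s' ≤ t`:
`m_{2k}(s') − m_{2k}(s) ≤ ν ∫_s^{s'} [ (γ_k/2) ∑_{0<j<k} C(k,j) C_G (1+min(j,k−j))^q (m_{2j+1} m_{2(k−j)} + m_{2j} m_{2(k−j)+1})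
  − (1 − γ_k)(K₁ m_{2k+1} − K₂ m_{2k}) ](r) dr`, `γ_k = C_SD/(k+1)`.
Route-internal definition of line Sketch, crux SuperExponentialEnergyTails, not a cited fact. -/
structure MomentSystem (t ν : ℝ) (n k₁ q : ℕ) (K₁ K₂ CG CSD E₁ C₀ A₀ : ℝ) (m : ℕ → ℝ → ℝ) : Prop where
  nonneg : ∀ (p : ℕ), ∀ s ∈ Set.Icc 0 t, 0 ≤ m p s
  mass_le : ∀ s ∈ Set.Icc 0 t, m 0 s ≤ 1
  energy_le : ∀ s ∈ Set.Icc 0 t, m 2 s ≤ E₁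
  continuousOn : ∀ p : ℕ, ContinuousOn (m p) (Set.Icc 0 t)
  lyapunov : ∀ p₀ p p₁ : ℕ, p₀ < p → p < p₁ → ∀ s ∈ Set.Icc 0 t,
    m p s ≤ m p₀ s ^ (((p₁ : ℝ) - p) / ((p₁ : ℝ) - p₀)) * m p₁ s ^ (((p : ℝ) - p₀) / ((p₁ : ℝ) - p₀))
  initial : ∀ k : ℕ, m (2 * k) 0 ≤ C₀ * A₀ ^ k * (k.factorial : ℝ)
  balance : ∀ k : ℕ, k₁ ≤ k → k ≤ n → ∀ s s' : ℝ, 0 ≤ s → s ≤ s' → s' ≤ t →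
    m (2 * k) s' - m (2 * k) s ≤ ν * ∫ r in s..s',
      ((CSD / ((k : ℝ) + 1) / 2) *
          ∑ j ∈ Finset.Ioo 0 k, (k.choose j : ℝ) * (CG * (1 + (min j (k - j) : ℝ)) ^ q) *
            (m (2 * j + 1) r * m (2 * (k - j)) r + m (2 * j) r * m (2 * (k - j) + 1) r)
        - (1 - CSD / ((k : ℝ) + 1)) * (K₁ * m (2 * k + 1) r - K₂ * m (2 * k) r))

/-- **`GevreyInduction` (provable; pure real analysis; the line's summation engine).**  For all admissible
constants there are `C, A > 0` — depending on `(k₁, q, K₁, K₂, C_G, C_SD, E₁, C₀, A₀)` ONLY — such that every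
`MomentSystem t ν n k₁ q … m` with `ν > 0` and `k₁ ≤ n` satisfies `m (2k) s ≤ C Aᵏ k^{3k/2}` for all `k ≤ n` and
`s ∈ [0, t]`: uniform in the horizon `t`, the frequency scale `ν` (which multiplies gain AND loss) and the
truncation order `n`.  Proof idea (Desvillettes / Bobylev; no generating functions needed in a Gevrey class):
(i) maximum principle for `x(s') − x(s) ≤ ν ∫ φ(x)` with `φ < 0` above a threshold, `x` continuous;
(ii) base orders: interpolate every moment of order in `(2, 2k)` between the energy and `m_{2k}` (Lyapunov), so the
gain is sub-linear `≲ m_{2k}^{(2k−3)/(2k−2)}` while the loss is super-linear `≳ K₁ m_{2k}^{1+1/(2k)}` (from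
`m_{2k} ≤ m_0^{1/(2k+1)} m_{2k+1}^{2k/(2k+1)}`, `m_0 ≤ 1`) — a bound `D_k` for each `k ≥ k₁` separately;
(iii) induction in the class `C Aᵏ (k!)^{3/2}` for `k ≥ k₂(C, ·)`: with the inductive bounds the cross terms are
`≲ C_SD C_G C² A^{k+1/2} (k!)^{3/2} k^{−3/4}` (the binomial `C(k,j)^{1−3/2}` kills the middle, the ends carry
`k^{−1/2}`; the single top-order term `2k C_G 2^q m_2 m_{2k−1}` is handled by `m_{2k−1} ≤ m_2^{1/(2k−2)} m_{2k}^{1−1/(2k−2)}`),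
against the loss `≳ K₁ C A^{k+1/2} (k!)^{3/2} (k/e)^{3/4}` at the level `C Aᵏ (k!)^{3/2}`; (iv) `A` large covers the
orders below `k₂` and the initial class.  Route-internal proposition of line Sketch, crux
SuperExponentialEnergyTails (registered stub `stub_gevreyInduction`), not a cited fact. -/
def GevreyInduction : Prop :=
  ∀ (k₁ q : ℕ) (K₁ K₂ CG CSD E₁ C₀ A₀ : ℝ), 2 ≤ k₁ → 0 < K₁ → 0 ≤ K₂ → 0 < CG → 0 < CSD →
    2 * CSD ≤ (k₁ : ℝ) + 1 → 0 ≤ E₁ → 0 < C₀ → 0 < A₀ →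
    ∃ C : ℝ, 0 < C ∧ ∃ A : ℝ, 0 < A ∧
      ∀ (t ν : ℝ) (n : ℕ) (m : ℕ → ℝ → ℝ), 0 < ν → k₁ ≤ n →
        MomentSystem t ν n k₁ q K₁ K₂ CG CSD E₁ C₀ A₀ m →
          ∀ k : ℕ, k ≤ n → ∀ s ∈ Set.Icc 0 t, m (2 * k) s ≤ C * A ^ k * (k : ℝ) ^ ((3 : ℝ) / 2 * k)

end Summit.AtomisticToContinuum.HydrodynamicLimit.Theorems.SuperExponentialEnergyTailsLine

end
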